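import Literature.NumberTheory.LFunctions.WeilFirstPrimeCertificateFacts
import Literature.NumberTheory.LFunctions.WeilCellsZ
import HarnessLib

/-!
# The first-prime minorant from ANY sound cell checker

Topic: `Literature/NumberTheory/LFunctions`. The chain layer of `WeilFirstPrimeMinorant.lean`
(the piecewise minorant `σ = wL − γ`, `γ = cellsGamma₂ wL cells`, of the first-prime Weil weight
`w₂(t) = Re ψ(1/4 + it/2) − √2 log 2 cos(t log 2)`, its vanishing beyond `T`, its moments, the
step bound `Σ_j bnd_j 1_{[u_j,v_j)}` of `|γ|` and its moments) is proved there from the RATIONAL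
cell checker `FPDCell.check`. The proofs use the per-cell checks only through four facts —
`0 ≤ u < v`, `σ ≤ w₂` on the cell, `|wL − σ| ≤ bndQ wL` on the cell — which the INTEGER checker
`FPDCell.checkZ` of `WeilCellsZ.lean` also provides. This file redoes the layer once and for all
from the abstract predicate

* `FPDCell.IsSound c wL` (the four facts), with `FPDCell.isSound_of_check`,
  `FPDCell.isSound_of_checkZ`;
* `SoundCells.*` — the chain lemmas from `∀ c ∈ cells, c.IsSound wL` (+ `checkChain₂`):
  `chain_bounds`, `gammaAux₂_eq_zero`, `gammaAux₂_spec`, `level_sub_cellsGamma₂_le`,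
  `cellsGamma₂_eq_zero`, `abs_gammaAux₂_le_step`, `stepAux_props`, `integral_stepAux_mul_pow`,
  `integral_gammaAux₂_mul_pow`, `integral_cellsGamma₂_mul_pow`, `stepAux_le_bndSum`,
  `stepAux_eq_zero`, `abs_cellsGamma₂_le_bndSum`, `integral_abs_cellsGamma₂_mul_pow_le`
  (proofs verbatim from `WeilFirstPrimeMinorant.lean`);
* **`cellsFacts_of_sound`**: a chain from `0` to `T` of sound cells with the tail-level condition
  `wL + √2 log 2 ≤ Re ψ(1/4 + iT/2)` yields the `CellsFacts wL T cells` of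
  `WeilFirstPrimeCertificateFacts.lean`, hence drives the certificate
  (`WeilCert2.weilFirstPrimeQuadratic_nonneg_of_parts`, `…_of_parts20`);
* an aggregate integer checker `checkCellsZ₂ p j wL T M cells` (chain, every cell `checkZ p j`,
  dyadic `T`, level test against `wLoZ`) with **`cellsFacts_of_checkCellsZ₂`**.

Everything here is proved; no named facts.

## References

* H. Yoshida, *On Hermitian forms attached to zeta functions*, Adv. Stud. Pure Math. 21 (1992), §6.
* R. E. Moore, *Interval Analysis* (1966), Ch. 3.
-/

noncomputable section

open Real Set MeasureTheory Filter
open scoped BigOperators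

namespace Literature.NumberTheory.LFunctions

open Literature.Analysis.SpecialFunctions
open Literature.Analysis.ValidatedNumerics.Numerics

/-! ## Sound cells -/

namespace FPDCell

/-- The analytic content of a checked first-prime cell at level `wL`: `0 ≤ u < v`, the minorant
property `σ(t) ≤ w₂(t)` on `[u, v]`, and the signed bound `|wL − σ(t)| ≤ bndQ wL` on `[u, v]`. [folklore] -/
structure IsSound (c : FPDCell) (wL : ℚ) : Prop where
  /-- `0 ≤ u` -/
  u_nonneg : 0 ≤ c.psi.u
  /-- `u < v` -/
  u_lt_v : c.psi.u < c.psi.v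
  /-- `σ ≤ w₂` on the cell -/
  sigma_le : ∀ ⦃t : ℝ⦄, (c.psi.u : ℝ) ≤ t → t ≤ (c.psi.v : ℝ) →
    c.sigma t ≤ reDigammaQuarter t - Real.sqrt 2 * Real.log 2 * Real.cos (t * Real.log 2)
  /-- `|wL − σ| ≤ bndQ wL` on the cell -/
  abs_level_sub_sigma_le : ∀ ⦃t : ℝ⦄, (c.psi.u : ℝ) ≤ t → t ≤ (c.psi.v : ℝ) →
    |(wL : ℝ) - c.sigma t| ≤ c.bndQ wL

/-- `0 ≤ bndQ wL` for a sound cell. [folklore] -/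
theorem IsSound.bndQ_nonneg {c : FPDCell} {wL : ℚ} (h : c.IsSound wL) : 0 ≤ c.bndQ wL :=
  bndQ_nonneg_of h.u_nonneg h.u_lt_v wL

/-- A cell accepted by the rational checker `check` is sound (at every level). [folklore] -/
theorem isSound_of_check {c : FPDCell} {p : ℕ} (h : c.check p = true) (wL : ℚ) : c.IsSound wL where
  u_nonneg := u_nonneg h
  u_lt_v := u_lt_v h
  sigma_le _ hut htv := sigma_le h hut htv
  abs_level_sub_sigma_le _ hut htv := abs_level_sub_sigma_le h wL hut htv

/-- A cell accepted by the integer checker `checkZ` is sound (at every level). [folklore] -/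
theorem isSound_of_checkZ {c : FPDCell} {p j : ℕ} (h : c.checkZ p j = true) (wL : ℚ) :
    c.IsSound wL where
  u_nonneg := u_nonneg_Z h
  u_lt_v := u_lt_v_Z h
  sigma_le _ hut htv := sigma_le_Z h hut htv
  abs_level_sub_sigma_le _ hut htv := abs_level_sub_sigma_le_Z h wL hut htv

end FPDCell

/-! ## The chain layer from sound cells -/

namespace SoundCells

variable {wL : ℚ}

/-- A checked chain from `s` to `T` of sound cells has `s ≤ T` and all cells inside `[s, T]`. [folklore] -/
theorem chain_bounds {cells : List FPDCell} {s T : ℚ} (hchain : checkChain₂ cells s T = true)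
    (hall : ∀ c ∈ cells, c.IsSound wL) :
    s ≤ T ∧ ∀ c ∈ cells, s ≤ c.psi.u ∧ c.psi.v ≤ T := by
  induction cells generalizing s with
  | nil =>
    simp only [checkChain₂, decide_eq_true_eq] at hchain
    exact ⟨hchain.le, fun c hc ↦ by simp at hc⟩
  | cons c cs ih =>
    simp only [checkChain₂, Bool.and_eq_true, decide_eq_true_eq] at hchain
    have hc := hall c (by simp)
    have huv := hc.u_lt_v
    have ih' := ih hchain.2 fun c' hc' ↦ hall c' (by simp [hc'])
    refine ⟨by rw [← hchain.1]; exact huv.le.trans ih'.1, fun c' hc' ↦ ?_⟩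
    simp only [List.mem_cons] at hc'
    rcases hc' with rfl | hc'
    · exact ⟨hchain.1.ge, ih'.1⟩
    · have := ih'.2 c' hc'
      exact ⟨hchain.1 ▸ huv.le.trans this.1, this.2⟩

/-- `γ_{≥0}` vanishes off `[s, T)`. [folklore] -/
theorem gammaAux₂_eq_zero {cells : List FPDCell} {s T : ℚ} (hchain : checkChain₂ cells s T = true)
    (hall : ∀ c ∈ cells, c.IsSound wL) {x : ℝ} (hx : x < s ∨ (T : ℝ) ≤ x) :
    gammaAux₂ wL cells x = 0 := by
  induction cells generalizing s with
  | nil => rfl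
  | cons c cs ih =>
    have hb := chain_bounds hchain hall
    simp only [checkChain₂, Bool.and_eq_true, decide_eq_true_eq] at hchain
    have hcv : (c.psi.v : ℝ) ≤ T := by exact_mod_cast (hb.2 c (by simp)).2
    have huv : (c.psi.u : ℝ) < c.psi.v := by exact_mod_cast (hall c (by simp)).u_lt_v
    have hus : (c.psi.u : ℝ) = s := by exact_mod_cast hchain.1
    simp only [gammaAux₂]
    rw [ih hchain.2 (fun c' hc' ↦ hall c' (by simp [hc'])) ?_, add_zero, Set.indicator_of_notMem]
    · rintro ⟨h1, h2⟩
      rcases hx with hx | hx <;> linarith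
    · rcases hx with hx | hx
      · left; linarith
      · right; exact hx

/-- On `[s, T)`, `γ_{≥0}(x) = wL − σ_j(x)` for the cell containing `x`. [folklore] -/
theorem gammaAux₂_spec {cells : List FPDCell} {s T : ℚ} (hchain : checkChain₂ cells s T = true)
    (hall : ∀ c ∈ cells, c.IsSound wL) {x : ℝ} (h1 : (s : ℝ) ≤ x) (h2 : x < T) :
    ∃ c ∈ cells, (c.psi.u : ℝ) ≤ x ∧ x < c.psi.v ∧ gammaAux₂ wL cells x = wL - c.sigma x := by
  induction cells generalizing s with
  | nil =>
    simp only [checkChain₂, decide_eq_true_eq] at hchain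
    rw [hchain] at h1
    linarith
  | cons c cs ih =>
    simp only [checkChain₂, Bool.and_eq_true, decide_eq_true_eq] at hchain
    have hus : (c.psi.u : ℝ) = s := by exact_mod_cast hchain.1
    have hall' : ∀ c' ∈ cs, c'.IsSound wL := fun c' hc' ↦ hall c' (by simp [hc'])
    by_cases hxv : x < c.psi.v
    · refine ⟨c, by simp, by linarith, hxv, ?_⟩
      simp only [gammaAux₂]
      have hmem : x ∈ Ico (c.psi.u : ℝ) c.psi.v := ⟨by linarith, hxv⟩
      rw [gammaAux₂_eq_zero hchain.2 hall' (Or.inl hxv), add_zero, Set.indicator_of_mem hmem]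
    · push Not at hxv
      obtain ⟨c', hc', hr⟩ := ih hchain.2 hall' hxv
      refine ⟨c', by simp [hc'], hr.1, hr.2.1, ?_⟩
      simp only [gammaAux₂]
      rw [Set.indicator_of_notMem (fun h ↦ not_lt.2 hxv h.2), zero_add, hr.2.2]

variable {T : ℚ} {cells : List FPDCell}

/-- **Soundness of the minorant from sound cells.** For a chain from `0` to `T` of sound cells
and the tail-level condition `wL + √2 log 2 ≤ Re ψ(1/4 + iT/2)`:
`wL − γ(t) ≤ w₂(t) = Re ψ(1/4 + it/2) − √2 log 2 cos(t log 2)` for all real `t`. [folklore] -/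
theorem level_sub_cellsGamma₂_le (hchain : checkChain₂ cells 0 T = true)
    (hall : ∀ c ∈ cells, c.IsSound wL)
    (hlevel : (wL : ℝ) + Real.sqrt 2 * Real.log 2 ≤ reDigammaQuarter T) (t : ℝ) :
    (wL : ℝ) - cellsGamma₂ wL cells t ≤
      reDigammaQuarter t - Real.sqrt 2 * Real.log 2 * Real.cos (t * Real.log 2) := by
  have hT : (0 : ℝ) ≤ T := by exact_mod_cast (chain_bounds hchain hall).1
  rw [← reDigammaQuarter_abs t, ← cos_abs_mul t]
  unfold cellsGamma₂
  have hx0 : (0 : ℝ) ≤ |t| := abs_nonneg t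
  rcases lt_or_ge |t| (T : ℝ) with hxT | hxT
  · obtain ⟨c, hc, hux, hxv, hval⟩ := gammaAux₂_spec hchain hall (by exact_mod_cast hx0) hxT
    rw [hval, sub_sub_cancel]
    exact (hall c hc).sigma_le hux hxv.le
  · rw [gammaAux₂_eq_zero hchain hall (Or.inr hxT), sub_zero]
    have hc0nn : 0 ≤ Real.sqrt 2 * Real.log 2 := by positivity
    have hcos : Real.sqrt 2 * Real.log 2 * Real.cos (|t| * Real.log 2) ≤ Real.sqrt 2 * Real.log 2 :=
      mul_le_of_le_one_right hc0nn (Real.cos_le_one _)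
    calc ((wL : ℚ) : ℝ) ≤ reDigammaQuarter T - Real.sqrt 2 * Real.log 2 := by linarith
      _ ≤ reDigammaQuarter |t| - Real.sqrt 2 * Real.log 2 := by
          linarith [reDigammaQuarter_mono (t := |t|) (u := (T : ℝ)) (by rwa [abs_abs, abs_of_nonneg hT])]
      _ ≤ reDigammaQuarter |t| - Real.sqrt 2 * Real.log 2 * Real.cos (|t| * Real.log 2) := by linarith

/-- `γ(t) = 0` for `|t| ≥ T`. [folklore] -/
theorem cellsGamma₂_eq_zero (hchain : checkChain₂ cells 0 T = true) (hall : ∀ c ∈ cells, c.IsSound wL)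
    {t : ℝ} (ht : (T : ℝ) ≤ |t|) : cellsGamma₂ wL cells t = 0 :=
  gammaAux₂_eq_zero hchain hall (Or.inr ht)

/-- `|γ_{≥0}(s)| ≤ step(s)` when all cells are sound. [folklore] -/
theorem abs_gammaAux₂_le_step (hall : ∀ c ∈ cells, c.IsSound wL) (s : ℝ) :
    |gammaAux₂ wL cells s| ≤ stepAux wL cells s := by
  induction cells with
  | nil => simp [gammaAux₂, stepAux]
  | cons c cs ih =>
    simp only [gammaAux₂, stepAux]
    refine (abs_add_le _ _).trans (add_le_add ?_ (ih fun c' hc' ↦ hall c' (by simp [hc'])))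
    by_cases hs : s ∈ Ico (c.psi.u : ℝ) c.psi.v
    · rw [Set.indicator_of_mem hs, Set.indicator_of_mem hs]
      exact (hall c (by simp)).abs_level_sub_sigma_le hs.1 hs.2.le
    · rw [Set.indicator_of_notMem hs, Set.indicator_of_notMem hs, abs_zero]

/-- `step` is bounded, nonnegative and measurable. [folklore] -/
theorem stepAux_props (hall : ∀ c ∈ cells, c.IsSound wL) :
    (∃ B, ∀ s, 0 ≤ stepAux wL cells s ∧ stepAux wL cells s ≤ B) ∧ Measurable (stepAux wL cells) := by
  induction cells with
  | nil => exact ⟨⟨0, fun s ↦ by simp [stepAux]⟩, measurable_const⟩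
  | cons c cs ih =>
    obtain ⟨⟨B, hB⟩, hm⟩ := ih fun c' hc' ↦ hall c' (by simp [hc'])
    have hb0 : (0 : ℝ) ≤ ((c.bndQ wL : ℚ) : ℝ) := by exact_mod_cast (hall c (by simp)).bndQ_nonneg
    refine ⟨⟨((c.bndQ wL : ℚ) : ℝ) + B, fun s ↦ ?_⟩, ?_⟩
    · simp only [stepAux]
      by_cases hs : s ∈ Ico (c.psi.u : ℝ) c.psi.v
      · rw [Set.indicator_of_mem hs]; exact ⟨add_nonneg hb0 (hB s).1, add_le_add le_rfl (hB s).2⟩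
      · rw [Set.indicator_of_notMem hs, zero_add]
        exact ⟨(hB s).1, (hB s).2.trans (by linarith)⟩
    · change Measurable fun s ↦
        Set.indicator (Ico (c.psi.u : ℝ) c.psi.v) (fun _ ↦ ((c.bndQ wL : ℚ) : ℝ)) s + stepAux wL cs s
      exact (measurable_const.indicator measurableSet_Ico).add hm

/-- **Moments of the step bound.** `s ↦ step(s) s^q` is integrable and
`∫ step(s) s^q ds = cellsAbsMomentQ`. [folklore] -/
theorem integral_stepAux_mul_pow (hall : ∀ c ∈ cells, c.IsSound wL) (q : ℕ) :
    Integrable (fun s ↦ stepAux wL cells s * s ^ q) ∧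
      ∫ s, stepAux wL cells s * s ^ q = (cellsAbsMomentQ wL cells q : ℝ) := by
  induction cells with
  | nil => simp [stepAux, cellsAbsMomentQ]
  | cons c cs ih =>
    obtain ⟨ihi, ihv⟩ := ih fun c' hc' ↦ hall c' (by simp [hc'])
    have huv : (c.psi.u : ℝ) ≤ c.psi.v := by exact_mod_cast (hall c (by simp)).u_lt_v.le
    have e : (fun s ↦ stepAux wL (c :: cs) s * s ^ q) = fun s ↦
        Set.indicator (Ico (c.psi.u : ℝ) c.psi.v) (fun s ↦ ((c.bndQ wL : ℚ) : ℝ) * s ^ q) s +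
          stepAux wL cs s * s ^ q := by
      funext s
      simp only [stepAux, add_mul, Set.indicator_mul_left]
    rw [e]
    have i1 : Integrable fun s : ℝ ↦
        Set.indicator (Ico (c.psi.u : ℝ) c.psi.v) (fun s ↦ ((c.bndQ wL : ℚ) : ℝ) * s ^ q) s := by
      rw [integrable_indicator_iff measurableSet_Ico]
      exact ((continuous_const.mul (continuous_pow q)).continuousOn.integrableOn_Icc
        (a := (c.psi.u : ℝ)) (b := c.psi.v)).mono_set Ico_subset_Icc_self
    refine ⟨i1.add ihi, ?_⟩
    rw [integral_add i1 ihi, ihv, integral_indicator measurableSet_Ico, integral_Ico_eq_integral_Ioo,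
      ← integral_Ioc_eq_integral_Ioo, ← intervalIntegral.integral_of_le huv,
      intervalIntegral.integral_const_mul, WeilCell.integral_pow_eq_powIntQ, cellsAbsMomentQ]
    push_cast
    ring

/-- **Moments of `γ_{≥0}`.** `s ↦ γ_{≥0}(s) s^q` is integrable and `∫ γ_{≥0}(s) s^q ds = Σ_j momentQ_j`. [folklore] -/
theorem integral_gammaAux₂_mul_pow (hall : ∀ c ∈ cells, c.IsSound wL) (q : ℕ) :
    Integrable (fun s ↦ gammaAux₂ wL cells s * s ^ q) ∧
      ∫ s, gammaAux₂ wL cells s * s ^ q = (cellsMomentQ₂ wL cells q : ℝ) := by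
  induction cells with
  | nil => simp [gammaAux₂, cellsMomentQ₂]
  | cons c cs ih =>
    obtain ⟨ihi, ihv⟩ := ih fun c' hc' ↦ hall c' (by simp [hc'])
    have huv : (c.psi.u : ℝ) ≤ c.psi.v := by exact_mod_cast (hall c (by simp)).u_lt_v.le
    have e : (fun s ↦ gammaAux₂ wL (c :: cs) s * s ^ q) = fun s ↦
        Set.indicator (Ico (c.psi.u : ℝ) c.psi.v) (fun s ↦ ((wL : ℝ) - c.sigma s) * s ^ q) s +
          gammaAux₂ wL cs s * s ^ q := by
      funext s
      simp only [gammaAux₂, add_mul, Set.indicator_mul_left]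
    rw [e]
    have i1 := integrable_indicator_cell₂ wL c q
    refine ⟨i1.add ihi, ?_⟩
    rw [integral_add i1 ihi, ihv, integral_indicator measurableSet_Ico, integral_Ico_eq_integral_Ioo,
      ← integral_Ioc_eq_integral_Ioo, ← intervalIntegral.integral_of_le huv,
      FPDCell.integral_level_sub_sigma_mul_pow, cellsMomentQ₂]
    push_cast
    ring

/-- **Moments of `γ`.** For even `q`, `t ↦ γ(t) t^q` is integrable and
`∫ γ(t) t^q dt = 2 Σ_j momentQ_j(q)`. [folklore] -/
theorem integral_cellsGamma₂_mul_pow (hchain : checkChain₂ cells 0 T = true)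
    (hall : ∀ c ∈ cells, c.IsSound wL) {q : ℕ} (hq : Even q) :
    Integrable (fun t ↦ cellsGamma₂ wL cells t * t ^ q) ∧
      ∫ t, cellsGamma₂ wL cells t * t ^ q = 2 * (cellsMomentQ₂ wL cells q : ℝ) := by
  obtain ⟨hFi, hFv⟩ := integral_gammaAux₂_mul_pow hall q
  set F : ℝ → ℝ := fun s ↦ gammaAux₂ wL cells s * s ^ q with hF
  have hev : (fun t ↦ cellsGamma₂ wL cells t * t ^ q) = fun t ↦ F |t| := by
    funext t
    rw [hF, cellsGamma₂]
    simp only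
    rw [hq.pow_abs]
  rw [hev]
  -- support of `F` is in `[0, T]`
  have hF0 : ∀ s, s ∉ Ici (0 : ℝ) → F s = 0 := fun s hs ↦ by
    rw [hF]
    simp only
    rw [gammaAux₂_eq_zero hchain hall (Or.inl (by simpa using hs)), zero_mul]
  constructor
  · -- integrability of `F ∘ |·|`: bounded with compact support, measurable
    obtain ⟨B, hB⟩ := exists_abs_gammaAux₂_le wL cells
    have hT0 : (0 : ℝ) ≤ T := by exact_mod_cast (chain_bounds hchain hall).1
    have hmeas : Measurable fun t ↦ F |t| := by
      rw [hF]
      exact ((measurable_gammaAux₂ wL cells).mul (measurable_id.pow_const q)).comp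
        continuous_abs.measurable
    have hconst : IntegrableOn (fun _ : ℝ ↦ B * (T : ℝ) ^ q) (Icc (-(T : ℝ)) T) :=
      integrableOn_const measure_Icc_lt_top.ne
    refine Integrable.mono' ((integrable_indicator_iff measurableSet_Icc).2 hconst)
      hmeas.aestronglyMeasurable (Eventually.of_forall fun t ↦ ?_)
    by_cases ht : |t| < T
    · have hmem : t ∈ Icc (-(T : ℝ)) T := ⟨by linarith [neg_abs_le t], by linarith [le_abs_self t]⟩
      rw [Set.indicator_of_mem hmem, hF, Real.norm_eq_abs]
      simp only
      rw [abs_mul, abs_pow, abs_abs]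
      exact mul_le_mul (hB _) (pow_le_pow_left₀ (abs_nonneg t) ht.le q) (by positivity)
        ((abs_nonneg _).trans (hB 0))
    · push Not at ht
      rw [hF, Real.norm_eq_abs]
      simp only
      rw [gammaAux₂_eq_zero hchain hall (Or.inr ht), zero_mul, abs_zero]
      exact Set.indicator_nonneg (fun _ _ ↦ by
        have := (abs_nonneg _).trans (hB 0); positivity) _
  · rw [integral_comp_abs (f := F), ← integral_Ici_eq_integral_Ioi,
      setIntegral_eq_integral_of_forall_compl_eq_zero hF0, hFv]

/-- `step(s) ≤ Σ_j bnd_j`. [folklore] -/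
theorem stepAux_le_bndSum (hall : ∀ c ∈ cells, c.IsSound wL) (s : ℝ) :
    stepAux wL cells s ≤ (cellsBndSumQ wL cells : ℝ) := by
  induction cells with
  | nil => simp [stepAux, cellsBndSumQ]
  | cons c cs ih =>
    simp only [stepAux, cellsBndSumQ]
    push_cast
    refine add_le_add ?_ (ih fun c' hc' ↦ hall c' (by simp [hc']))
    have hb0 : (0 : ℝ) ≤ ((c.bndQ wL : ℚ) : ℝ) := by exact_mod_cast (hall c (by simp)).bndQ_nonneg
    by_cases hs : s ∈ Ico (c.psi.u : ℝ) c.psi.v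
    · rw [Set.indicator_of_mem hs]
    · rw [Set.indicator_of_notMem hs]; exact hb0

/-- `0 ≤ Σ_j bnd_j`. [folklore] -/
theorem cellsBndSumQ_nonneg (hall : ∀ c ∈ cells, c.IsSound wL) :
    (0 : ℝ) ≤ (cellsBndSumQ wL cells : ℝ) :=
  le_trans ((stepAux_props (wL := wL) hall).1.choose_spec 0).1 (stepAux_le_bndSum hall 0)

/-- `step` vanishes off `[s₀, T)` for a checked chain of sound cells from `s₀` to `T`. [folklore] -/
theorem stepAux_eq_zero {s₀ : ℚ} (hchain : checkChain₂ cells s₀ T = true)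
    (hall : ∀ c ∈ cells, c.IsSound wL) {x : ℝ} (hx : x < s₀ ∨ (T : ℝ) ≤ x) :
    stepAux wL cells x = 0 := by
  induction cells generalizing s₀ with
  | nil => rfl
  | cons c cs ih =>
    have hb := chain_bounds hchain hall
    simp only [checkChain₂, Bool.and_eq_true, decide_eq_true_eq] at hchain
    have hcv : (c.psi.v : ℝ) ≤ T := by exact_mod_cast (hb.2 c (by simp)).2
    have huv : (c.psi.u : ℝ) < c.psi.v := by exact_mod_cast (hall c (by simp)).u_lt_v
    have hus : (c.psi.u : ℝ) = s₀ := by exact_mod_cast hchain.1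
    simp only [stepAux]
    rw [ih hchain.2 (fun c' hc' ↦ hall c' (by simp [hc'])) ?_, add_zero, Set.indicator_of_notMem]
    · rintro ⟨h1, h2⟩
      rcases hx with hx | hx <;> linarith
    · rcases hx with hx | hx
      · left; linarith
      · right; exact hx

/-- **Sup bound for the signed minorant.** `|γ(t)| ≤ Σ_j bnd_j` for all real `t`. [folklore] -/
theorem abs_cellsGamma₂_le_bndSum (hall : ∀ c ∈ cells, c.IsSound wL) (t : ℝ) :
    |cellsGamma₂ wL cells t| ≤ (cellsBndSumQ wL cells : ℝ) := by
  unfold cellsGamma₂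
  exact (abs_gammaAux₂_le_step hall |t|).trans (stepAux_le_bndSum hall |t|)

/-- **`|γ|`-moments.** For even `q`, `t ↦ |γ(t)| t^q` is integrable and
`∫ |γ(t)| t^q dt ≤ 2 · cellsAbsMomentQ(q)`. [folklore] -/
theorem integral_abs_cellsGamma₂_mul_pow_le (hchain : checkChain₂ cells 0 T = true)
    (hall : ∀ c ∈ cells, c.IsSound wL) {q : ℕ} (hq : Even q) :
    Integrable (fun t ↦ |cellsGamma₂ wL cells t| * t ^ q) ∧
      ∫ t, |cellsGamma₂ wL cells t| * t ^ q ≤ 2 * (cellsAbsMomentQ wL cells q : ℝ) := by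
  obtain ⟨hFi, -⟩ := integral_cellsGamma₂_mul_pow hchain hall hq
  obtain ⟨⟨B, hB⟩, hSm⟩ := stepAux_props (wL := wL) hall
  obtain ⟨-, hSv⟩ := integral_stepAux_mul_pow (wL := wL) hall q
  have hev : (fun t ↦ |cellsGamma₂ wL cells t| * t ^ q) = fun t ↦ |cellsGamma₂ wL cells t * t ^ q| := by
    funext t; rw [abs_mul, abs_pow, hq.pow_abs]
  have hint : Integrable (fun t ↦ |cellsGamma₂ wL cells t| * t ^ q) := by rw [hev]; exact hFi.abs
  refine ⟨hint, ?_⟩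
  set G : ℝ → ℝ := fun s ↦ stepAux wL cells s * s ^ q with hG
  have hG0 : ∀ s, s ∉ Ici (0 : ℝ) → G s = 0 := fun s hs ↦ by
    rw [hG]; simp only
    rw [stepAux_eq_zero hchain hall (Or.inl (by simpa using hs)), zero_mul]
  have hle : ∀ t, |cellsGamma₂ wL cells t| * t ^ q ≤ G |t| := by
    intro t
    rw [hG]; simp only
    rw [hq.pow_abs]
    refine mul_le_mul_of_nonneg_right ?_ (by rw [← hq.pow_abs]; positivity)
    unfold cellsGamma₂
    exact abs_gammaAux₂_le_step hall |t|
  -- integrability of `G ∘ |·|`: bounded with support in `[-T, T]`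
  have hT0 : (0 : ℝ) ≤ T := by exact_mod_cast (chain_bounds hchain hall).1
  have hB0 : 0 ≤ B := (hB 0).1.trans (hB 0).2
  have hmeas : Measurable fun t ↦ G |t| := by
    rw [hG]; exact (hSm.mul (measurable_id.pow_const q)).comp continuous_abs.measurable
  have hconst : IntegrableOn (fun _ : ℝ ↦ B * (T : ℝ) ^ q) (Icc (-(T : ℝ)) T) :=
    integrableOn_const measure_Icc_lt_top.ne
  have hGi : Integrable fun t ↦ G |t| := by
    refine Integrable.mono' ((integrable_indicator_iff measurableSet_Icc).2 hconst)
      hmeas.aestronglyMeasurable (Eventually.of_forall fun t ↦ ?_)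
    by_cases ht : |t| < T
    · have hmem : t ∈ Icc (-(T : ℝ)) T := ⟨by linarith [neg_abs_le t], by linarith [le_abs_self t]⟩
      rw [Set.indicator_of_mem hmem, hG, Real.norm_eq_abs]
      simp only
      rw [abs_mul, abs_pow, abs_abs, abs_of_nonneg (hB _).1]
      exact mul_le_mul (hB _).2 (pow_le_pow_left₀ (abs_nonneg t) ht.le q) (by positivity) hB0
    · push Not at ht
      rw [hG, Real.norm_eq_abs]
      simp only
      rw [stepAux_eq_zero hchain hall (Or.inr ht), zero_mul, abs_zero]
      exact Set.indicator_nonneg (fun _ _ ↦ by positivity) _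
  have hmono := integral_mono hint hGi hle
  refine hmono.trans (le_of_eq ?_)
  rw [integral_comp_abs (f := G), ← integral_Ici_eq_integral_Ioi,
    setIntegral_eq_integral_of_forall_compl_eq_zero hG0, hSv]

end SoundCells

/-! ## `CellsFacts` from sound cells -/

/-- **The certificate's cell facts from any sound cell checker.** A chain of sound cells from `0`
to `T` with the tail-level condition `wL + √2 log 2 ≤ Re ψ(1/4 + iT/2)` has all the analytic
properties the first-prime certificate consumes. [folklore] -/
theorem cellsFacts_of_sound {wL T : ℚ} {cells : List FPDCell} (hchain : checkChain₂ cells 0 T = true)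
    (hall : ∀ c ∈ cells, c.IsSound wL)
    (hlevel : (wL : ℝ) + Real.sqrt 2 * Real.log 2 ≤ reDigammaQuarter T) : CellsFacts wL T cells where
  level_le := SoundCells.level_sub_cellsGamma₂_le hchain hall hlevel
  eq_zero _ ht := SoundCells.cellsGamma₂_eq_zero hchain hall ht
  moment _ hq := SoundCells.integral_cellsGamma₂_mul_pow hchain hall hq
  absMoment _ hq := SoundCells.integral_abs_cellsGamma₂_mul_pow_le hchain hall hq
  abs_le := SoundCells.abs_cellsGamma₂_le_bndSum hall

/-- The tail-level condition from a rational test `wL + cHi ≤ wLo` against certified bounds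
`wLo ≤ Re ψ(1/4 + iT/2)` and `√2 log 2 ≤ cHi`. [folklore] -/
theorem level_of_le {wL cHi wLo : ℚ} {T : ℝ} (h : wL + cHi ≤ wLo) (hwLo : (wLo : ℝ) ≤ reDigammaQuarter T)
    (hc : Real.sqrt 2 * Real.log 2 ≤ (cHi : ℝ)) : (wL : ℝ) + Real.sqrt 2 * Real.log 2 ≤ reDigammaQuarter T := by
  have h' : ((wL : ℚ) : ℝ) + cHi ≤ wLo := by exact_mod_cast h
  linarith

/-! ## An aggregate integer checker -/

/-- All checks of a certified first-prime minorant on `[0, T]` at level `wL`, INTEGER form: a chain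
of cells from `0` to `T`, every cell accepted by `FPDCell.checkZ p j`, `T = a/2^j` dyadic
(`a = dyNum T j`, `j ≥ 1`), and the level test `wL + (√2 log 2)⁺ ≤ wLoZ p a j M`. [folklore] -/
def checkCellsZ₂ (p j : ℕ) (wL T : ℚ) (M : ℕ) (cells : List FPDCell) : Bool :=
  checkChain₂ cells 0 T && cells.all (fun c ↦ c.checkZ p j) && decide (1 ≤ j) &&
    decide (T * 2 ^ j = ((dyNum T j : ℕ) : ℚ)) && decide (wL + cZeroFI.hiQ ≤ wLoZ p (dyNum T j) j M)

/-- Unpacking `checkCellsZ₂`. [folklore] -/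
theorem checkCellsZ₂_spec {p j : ℕ} {wL T : ℚ} {M : ℕ} {cells : List FPDCell}
    (h : checkCellsZ₂ p j wL T M cells = true) :
    checkChain₂ cells 0 T = true ∧ (∀ c ∈ cells, c.checkZ p j = true) ∧ 1 ≤ j ∧
      T * 2 ^ j = ((dyNum T j : ℕ) : ℚ) ∧ wL + cZeroFI.hiQ ≤ wLoZ p (dyNum T j) j M := by
  simp only [checkCellsZ₂, Bool.and_eq_true, List.all_eq_true, decide_eq_true_eq] at h
  exact ⟨h.1.1.1.1, h.1.1.1.2, h.1.1.2, h.1.2, h.2⟩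

/-- **The cell facts from the integer checker.** [folklore] -/
theorem cellsFacts_of_checkCellsZ₂ {p j : ℕ} {wL T : ℚ} {M : ℕ} {cells : List FPDCell}
    (h : checkCellsZ₂ p j wL T M cells = true) : CellsFacts wL T cells := by
  obtain ⟨hchain, hall, hj, hT, hwL⟩ := checkCellsZ₂_spec h
  refine cellsFacts_of_sound hchain (fun c hc ↦ FPDCell.isSound_of_checkZ (hall c hc) wL) ?_
  have h1 := wLoZ_le p (dyNum T j) hj M
  have hTr : ((dyNum T j : ℕ) : ℝ) / 2 ^ j = (T : ℝ) := by
    have : (T : ℝ) * 2 ^ j = ((dyNum T j : ℕ) : ℝ) := by exact_mod_cast hT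
    rw [← this, mul_div_assoc, div_self (by positivity), mul_one]
  rw [hTr] at h1
  exact level_of_le hwL h1 (FI.le_hiQ mem_cZeroFI)

end Literature.NumberTheory.LFunctions
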